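import Summits.QuantumFields.BalabanUV.Beta.GAN24.WoodburyFibreProjector
import Literature.MathematicalPhysics.QuantumFieldTheory.Balaban1983to89.B4Thm110ZeroBoxDeriv

/-!
# Beta / GAN24 / WoodburyFibreProjectorDeriv — census row V12: the DERIVATIVE entries of Bałaban's (3.49) at `U = 1` on the Neumann
boxes — `n·D_μP`, `n·P D_ν*`, `n²·D_μ P D_ν*` (`P = 1 − R`) are `O(n^{−(d+1)})·e^{−δ·(block distance)}` UNIFORMLY IN THE SCALE `n = L^k`

Cell `pub-balaban`, β sub-cell, BINDER ROW **G-an2-4 ∕ (CONV-C)** («NOT IN PRINT; our proof attempt»), prover part **P3 = WOODBURY-FIBRE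
reduction** (lineage `b2b-balaban-gan24-p3`, gen 7).  HONEST FRAMING (verbatim): discharging `BetaPertH` makes Bałaban's UV stability
UNCONDITIONAL — a real constructive-QFT result; it is NOT the continuum limit and NOT the Clay problem.  HONEST DEPENDENCY: continuum YM
on T⁴ ⇐ BetaPertH ∧ nine spine estimates (0/9 proved); BetaPertH ⇐ (D1) ∧ (D4) ∧ CAP+tail; G-an2-4 gates asym, D1 and NE2/3/4.
`[folklore]`; 0 sorry; B4's derivative clause enters BY NAME (`B4Thm110ZeroBoxDeriv.thm110_zero_box_deriv_roww_coeff`, a tree theorem);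
nothing printed and nothing programme-internal is a hypothesis.  NOT (CONV-C), NOT «G-an2-4 closed», NOT `BetaPertH`.

PRINT LOCATOR (NOT a hypothesis; this file REPRODUCES its `U = 1`, one-domain case on Bałaban's Neumann boxes at `A = 0`): [B9] T. Bałaban,
CMP **99** (1985) p. 399 (3.49), journal render re-read by this seat: «For the operator P = I − R we obtain, using again Lemma 2.1,
[|P(x,x′)|, |(DP)_μ(x,x′)|, |(PD*)_ν(x,x′)|, |(DPD*)_{μν}(x,x′)|] ≤ O(1)[1, (L^jη)^{−1}, (L^jη)^{−1}, (L^jη)^{−2}](L^{j′}η)^{−d} e^{−(1/2)δ₀d(y,y′)}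
for x ∈ Δ(y), y ∈ Λ_j, x′ ∈ Δ(y′), y′ ∈ Λ_{j′}.»  In the box normalisation of this lineage (unit fine lattice, `n = L^k` sites per block side,
`L_n = n²(−Δ^N)`): the lattice difference `D` of the `η`-lattice is `n·`(unit forward difference), `(L^{j′}η)^{−d}` is `n^{−(d+1)}`; the
`P`-entry itself is gen 7's `WoodburyFibreProjector.one_sub_projR_decay`.

CONTENTS.  §1 row∕column forward differences of box-indexed matrices, scaled by `t` and set to `0` where the shifted point leaves the box
(`shiftDiff μ t A`, `shiftDiffCol ν t A`; they commute with multiplication on the other side, `shiftDiff_mul`, `mul_shiftDiffCol`, and are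
conjugate-transposes of each other); the pointwise readings `n(P(x+e_μ,x′) − P(x,x′))`, `n²(P(x+e_μ,x′+e_ν) − … + P(x,x′))`.  §2 B4 (1.10)'s
DERIVATIVE clause in the cube currency for all scales (`cubeDecay_boxGreen_deriv` ← `thm110_zero_box_deriv_roww_coeff` BY NAME through gen 6's
`cubeDecay_of_roww`), and the differentiated minimiser `n·D_μℋ̃ = (n·D_μG)·Qnᴴ·pivot⁻¹` with its entrywise decay.  §3 **`one_sub_projR_deriv_decay
(d ℓ) (hℓ : 1 ≤ ℓ)`: ∃ δ C > 0, ∀ k ≥ 1, ∀ boxes, ∀ μ ν: `PosDecay (n·D_μP) (C·n^{−(d+1)}) δ`, `CubeDecay (n·D_μP) C δ`, `PosDecay (n·P D_ν*) (C·n^{−(d+1)}) δ`,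
`PosDecay (n²·D_μ P D_ν*) (C·n^{−(d+1)}) δ`** — since `P = ℋ̃(ℋ̃ᴴℋ̃)⁻¹ℋ̃ᴴ` (gen 7's `one_sub_projR`), `n·D_μP = (n·D_μℋ̃)(ℋ̃ᴴℋ̃)⁻¹ℋ̃ᴴ` etc.,
and the chain of gen 6∕7 (legs, finite Combes–Thomas on `ℋ̃ᴴℋ̃ ⪰ 1`) applies with `n·D_μG` in place of `G` on the differentiated side.
-/

namespace Summit.QuantumFields.BalabanUV.Beta.GAN24.WoodburyFibreProjectorDeriv

open Finset Matrix
open Literature.MathematicalPhysics.QuantumFieldTheory.Balaban1983to89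
open B4ContourShift (supNorm)
open B4Reflection242 (boxDom)
open B4BoxCov237 (boxOpR indB rho rho_isPseudoDist boxOpR_isUnit)
open B4Sect5Torus (IsPseudoDist rate rate_pos rate_le_quarter)
open B4Sect5Proof (latticeConst)
open B5Decay126 (PosDecay PosProfile)
open B6QGQLower276 (gammaQ gammaQ_pos)
open Summit.QuantumFields.BalabanUV.Beta.PropagatorWoodburyFibre (pivot minimiser flucCov)
open WoodburyFibreGaugeDecay (posDecay_conjTranspose)
open WoodburyFibreGaugeCubeDecay (CubeDecay ColCubeDecay posDecay_mul_colCube gram_posDecay)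
open WoodburyFibreBoxQGQ (fineN blkBox qGq_box_coercive)
open WoodburyFibreGaugeInputs
open WoodburyFibreGaugeBox
open WoodburyFibreLandauBox (piH dStar dOne)
open WoodburyFibreProjector (projR one_sub_projR gram_coercive isUnit_pivot_one dOne_pos)

noncomputable section

variable {d : ℕ}

/-! ## §1 Scaled forward differences of box-indexed matrices -/

section Diff

variable {N : Fin (d + 1) → ℕ} {κ κ' : Type*}

/-- `shiftDiff μ t A`: the row `x ↦ t·(A(x + e_μ, ·) − A(x, ·))`, set to `0` when `x + e_μ` leaves the box. [folklore] -/
def shiftDiff (μ : Fin (d + 1)) (t : ℝ) (A : Matrix ↥(boxDom N) κ ℝ) : Matrix ↥(boxDom N) κ ℝ :=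
  fun x j => if h : x.1 + Pi.single μ 1 ∈ boxDom N then t * (A ⟨x.1 + Pi.single μ 1, h⟩ j - A x j) else 0

/-- `shiftDiffCol ν t A`: the column `x′ ↦ t·(A(·, x′ + e_ν) − A(·, x′))`, set to `0` when `x′ + e_ν` leaves the box. [folklore] -/
def shiftDiffCol (ν : Fin (d + 1)) (t : ℝ) (A : Matrix κ ↥(boxDom N) ℝ) : Matrix κ ↥(boxDom N) ℝ :=
  fun i x' => if h : x'.1 + Pi.single ν 1 ∈ boxDom N then t * (A i ⟨x'.1 + Pi.single ν 1, h⟩ - A i x') else 0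

/-- reading of a row difference inside the box. [folklore] -/
theorem shiftDiff_apply_of_mem (μ : Fin (d + 1)) (t : ℝ) (A : Matrix ↥(boxDom N) κ ℝ) (x : ↥(boxDom N))
    (hx : x.1 + Pi.single μ 1 ∈ boxDom N) (j : κ) : shiftDiff μ t A x j = t * (A ⟨x.1 + Pi.single μ 1, hx⟩ j - A x j) := by
  simp only [shiftDiff, dif_pos hx]

/-- reading of a column difference inside the box. [folklore] -/
theorem shiftDiffCol_apply_of_mem (ν : Fin (d + 1)) (t : ℝ) (A : Matrix κ ↥(boxDom N) ℝ) (i : κ) (x' : ↥(boxDom N))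
    (hx' : x'.1 + Pi.single ν 1 ∈ boxDom N) : shiftDiffCol ν t A i x' = t * (A i ⟨x'.1 + Pi.single ν 1, hx'⟩ - A i x') := by
  simp only [shiftDiffCol, dif_pos hx']

/-- reading of the mixed second difference inside the box: `t·s·(A(x+e_μ, x′+e_ν) − A(x+e_μ, x′) − A(x, x′+e_ν) + A(x, x′))`. [folklore] -/
theorem shiftDiff_shiftDiffCol_apply_of_mem (μ ν : Fin (d + 1)) (t s : ℝ) (A : Matrix ↥(boxDom N) ↥(boxDom N) ℝ)
    (x x' : ↥(boxDom N)) (hx : x.1 + Pi.single μ 1 ∈ boxDom N) (hx' : x'.1 + Pi.single ν 1 ∈ boxDom N) :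
    shiftDiff μ t (shiftDiffCol ν s A) x x' = t * s * (A ⟨x.1 + Pi.single μ 1, hx⟩ ⟨x'.1 + Pi.single ν 1, hx'⟩
      - A ⟨x.1 + Pi.single μ 1, hx⟩ x' - A x ⟨x'.1 + Pi.single ν 1, hx'⟩ + A x x') := by
  simp only [shiftDiff, shiftDiffCol, dif_pos hx, dif_pos hx']
  ring

/-- row differences commute with right multiplication. [folklore] -/
theorem shiftDiff_mul [Fintype κ] (μ : Fin (d + 1)) (t : ℝ) (A : Matrix ↥(boxDom N) κ ℝ) (B : Matrix κ κ' ℝ) :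
    shiftDiff μ t (A * B) = shiftDiff μ t A * B := by
  ext x j
  by_cases hx : x.1 + Pi.single μ 1 ∈ boxDom N
  · simp only [shiftDiff, dif_pos hx, Matrix.mul_apply]
    rw [← Finset.sum_sub_distrib, Finset.mul_sum]
    exact Finset.sum_congr rfl fun k _ => by ring
  · simp only [shiftDiff, dif_neg hx, Matrix.mul_apply, zero_mul, Finset.sum_const_zero]

/-- column differences commute with left multiplication. [folklore] -/
theorem mul_shiftDiffCol [Fintype κ] (ν : Fin (d + 1)) (t : ℝ) (A : Matrix κ' κ ℝ) (B : Matrix κ ↥(boxDom N) ℝ) :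
    shiftDiffCol ν t (A * B) = A * shiftDiffCol ν t B := by
  ext i x'
  by_cases hx' : x'.1 + Pi.single ν 1 ∈ boxDom N
  · simp only [shiftDiffCol, dif_pos hx', Matrix.mul_apply]
    rw [← Finset.sum_sub_distrib, Finset.mul_sum]
    exact Finset.sum_congr rfl fun k _ => by ring
  · simp only [shiftDiffCol, dif_neg hx', Matrix.mul_apply, mul_zero, Finset.sum_const_zero]

/-- the column difference of a conjugate transpose is the conjugate transpose of the row difference. [folklore] -/
theorem shiftDiffCol_conjTranspose (ν : Fin (d + 1)) (t : ℝ) (A : Matrix ↥(boxDom N) κ ℝ) :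
    shiftDiffCol ν t Aᴴ = (shiftDiff ν t A)ᴴ := by
  ext i x'
  simp only [shiftDiffCol, shiftDiff, conjTranspose_apply, star_trivial]

end Diff

/-! ## §2 B4 (1.10)'s derivative clause in the cube currency; the differentiated legs -/

/-- **B4 (1.10), DERIVATIVE CLAUSE, IN THE CUBE CURRENCY, ALL SCALES**: `n·D_μG_k(□)` has block row sums `≤ c₀·e^{−δ₀·rho(blk x, b′)}` for every
`k ≥ 1`, every `(a, m²)` in the window, every box and every axis — `B4Thm110ZeroBoxDeriv.thm110_zero_box_deriv_roww_coeff` BY NAME. [folklore] -/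
theorem cubeDecay_boxGreen_deriv (d ℓ : ℕ) (hℓ : 1 ≤ ℓ) (amin aplus m2plus : ℝ) (ha : 0 < amin) :
    ∃ δ₀ c₀ : ℝ, 0 < δ₀ ∧ 0 < c₀ ∧ ∀ (k : ℕ) (hk : 1 ≤ k), ∀ (a m2 : ℝ), amin ≤ a → a ≤ aplus → 0 ≤ m2 → m2 ≤ m2plus →
      ∀ (M : Fin (d + 1) → ℕ), (∀ i, 1 ≤ M i) → ∀ μ : Fin (d + 1),
        CubeDecay (rho M) (blkBox (Nat.one_le_pow k (ℓ + 1) (Nat.succ_pos ℓ)) M) id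
          (shiftDiff μ ((((ℓ + 1) ^ k : ℕ)) : ℝ) (boxOpR ((ℓ + 1) ^ k) a m2 M)⁻¹) c₀ δ₀ := by
  obtain ⟨δ₀, c₀, hδ, hc, h⟩ := B4Thm110ZeroBoxDeriv.thm110_zero_box_deriv_roww_coeff d ℓ hℓ amin aplus m2plus ha
  refine ⟨δ₀, c₀ * Real.exp δ₀, hδ, by positivity, fun k hk a m2 h1 h2 h3 h4 M hM μ => ?_⟩
  refine cubeDecay_of_roww _ _ hδ.le hc.le fun x => ?_
  by_cases hx : x.1 + Pi.single μ 1 ∈ boxDom (fineN ((ℓ + 1) ^ k) M)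
  · have hb := h k hk a m2 h1 h2 h3 h4 M hM μ x ⟨x.1 + Pi.single μ 1, hx⟩ rfl
    refine le_of_eq_of_le (Finset.sum_congr rfl fun x' _ => ?_) hb
    rw [shiftDiff_apply_of_mem μ _ _ x hx]
  · have hz : ∀ x', |shiftDiff μ ((((ℓ + 1) ^ k : ℕ)) : ℝ) (boxOpR ((ℓ + 1) ^ k) a m2 M)⁻¹ x x'| = 0 := fun x' => by
      simp only [shiftDiff, dif_neg hx, abs_zero]
    simp_rw [hz, zero_mul, Finset.sum_const_zero]
    exact hc.le

section Legs

variable {n : ℕ} (hn : 1 ≤ n) (M : Fin (d + 1) → ℕ) (hM : ∀ i, 1 ≤ M i)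

/-- the differentiated leg `(n·D_μG)·Qnᴴ`, entrywise (constant `s·c`, `s = n^{−(d+1)∕2}`). [folklore] -/
theorem posDecay_dG_QnT {μ : Fin (d + 1)} {c δ : ℝ} (hdG : CubeDecay (rho M) (blkBox hn M) id (shiftDiff μ (n : ℝ) (boxOpR n 1 0 M)⁻¹) c δ) :
    PosDecay (rho M) (id ∘ blkBox hn M) id (shiftDiff μ (n : ℝ) (boxOpR n 1 0 M)⁻¹ * (Qn n M)ᴴ) (sN d n * c) δ := by
  rw [Qn_conjTranspose, Matrix.mul_smul]
  have h := (posDecay_G_indBT hn M hdG).smul (sN d n)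
  rwa [abs_of_pos (sN_pos hn)] at h

/-- **THE DIFFERENTIATED MINIMISER** `n·D_μℋ̃ = (n·D_μG)·Qnᴴ·(Q_kG_kQ_k^*)⁻¹`, entrywise: `PosDecay (s·c·(2∕γ)·K(δP∕2)) (δP∕2)`, exactly the shape
of gen 6's `posDecay_minimiser` with the derivative constant `c` in place of `cG` on the differentiated leg. [folklore] -/
theorem posDecay_dMinimiser {μ : Fin (d + 1)} {cG c δ γ : ℝ} (hδ : 0 < δ) (hγ : 0 < γ)
    (hG : CubeDecay (rho M) (blkBox hn M) id (boxOpR n 1 0 M)⁻¹ cG δ)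
    (hdG : CubeDecay (rho M) (blkBox hn M) id (shiftDiff μ (n : ℝ) (boxOpR n 1 0 M)⁻¹) c δ)
    (hco : QGQInverse.Coercive ((((n : ℝ) ^ (d + 1))⁻¹) • (indB n M * (boxOpR n 1 0 M)⁻¹ * (indB n M)ᵀ)) γ) :
    PosDecay (rho M) (id ∘ blkBox hn M) id (shiftDiff μ (n : ℝ) (minimiser (boxOpR n 1 0 M) (Qn n M)))
      (sN d n * c * (2 / γ) * latticeConst (d + 1) (rate (latticeConst (d + 1)) γ cG δ / 2))
      (rate (latticeConst (d + 1)) γ cG δ / 2) := by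
  have hP := rate_pos (latticeConst_nonneg' d) hγ hG.1 hδ
  have h4 : rate (latticeConst (d + 1)) γ cG δ ≤ δ / 4 := rate_le_quarter _ _ _
  rw [minimiser_eq, shiftDiff_mul, shiftDiff_mul]
  exact PosDecay.mul (rho_isPseudoDist M) (latticeConst_nonneg' d) (posProfile_rho M) (posDecay_dG_QnT hn M hdG)
    (posDecay_pivotQn_inv hn M hδ hγ hG hco) (by positivity) (by positivity) (by linarith) (by linarith)

end Legs

/-! ## §3 The derivative entries of `P = 1 − R`, uniformly in the scale -/

/-- the constant of the first-derivative entries (cube currency; entrywise it is multiplied by `n^{−(d+1)}`): `c` = B4's derivative constant,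
`cG` = B4's value constant. [folklore] -/
def dConst (K : ℝ → ℝ) (γ cG c δ : ℝ) : ℝ :=
  c * cG * (2 / γ) ^ 2 * K (rate K γ cG δ / 2) ^ 2 * 2 * K (dOne K γ cG δ / 2) * K (dOne K γ cG δ / 4)

/-- the constant of the mixed second-derivative entry. [folklore] -/
def ddConst (K : ℝ → ℝ) (γ cG c δ : ℝ) : ℝ :=
  c * c * (2 / γ) ^ 2 * K (rate K γ cG δ / 2) ^ 2 * 2 * K (dOne K γ cG δ / 2) * K (dOne K γ cG δ / 4)

/-- **THE DERIVATIVE ENTRIES ON ONE BOX FROM THE SCALAR DATA**: cube decay `(cG, δ)` of `G = (boxOpR n 1 0 M)⁻¹`, `(c, δ)` of `n·D_μG` (every `μ`)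
and coercivity `γ` of `Q_kG_kQ_k^*` give, for `P = 1 − projR n M` and all axes: `n·D_μP` entrywise `n^{−(d+1)}·dConst`, in cubes `dConst`;
`n·P D_ν*` entrywise `n^{−(d+1)}·dConst`; `n²·D_μ P D_ν*` entrywise `n^{−(d+1)}·ddConst` — all at rate `dOne∕4`. [folklore] -/
theorem one_sub_projR_deriv_of_data {n : ℕ} (hn : 1 ≤ n) (M : Fin (d + 1) → ℕ) (hM : ∀ i, 1 ≤ M i) {cG c δ γ : ℝ}
    (hδ : 0 < δ) (hγ : 0 < γ) (hG : CubeDecay (rho M) (blkBox hn M) id (boxOpR n 1 0 M)⁻¹ cG δ)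
    (hdG : ∀ μ, CubeDecay (rho M) (blkBox hn M) id (shiftDiff μ (n : ℝ) (boxOpR n 1 0 M)⁻¹) c δ)
    (hco : QGQInverse.Coercive ((((n : ℝ) ^ (d + 1))⁻¹) • (indB n M * (boxOpR n 1 0 M)⁻¹ * (indB n M)ᵀ)) γ) (μ ν : Fin (d + 1)) :
    PosDecay (rho M) (id ∘ blkBox hn M) (id ∘ blkBox hn M) (shiftDiff μ (n : ℝ) (1 - projR n M))
        ((((n : ℝ) ^ (d + 1))⁻¹) * dConst (latticeConst (d + 1)) γ cG c δ) (dOne (latticeConst (d + 1)) γ cG δ / 4)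
      ∧ CubeDecay (rho M) (blkBox hn M) id (shiftDiff μ (n : ℝ) (1 - projR n M))
        (dConst (latticeConst (d + 1)) γ cG c δ) (dOne (latticeConst (d + 1)) γ cG δ / 4)
      ∧ PosDecay (rho M) (id ∘ blkBox hn M) (id ∘ blkBox hn M) (shiftDiffCol ν (n : ℝ) (1 - projR n M))
        ((((n : ℝ) ^ (d + 1))⁻¹) * dConst (latticeConst (d + 1)) γ cG c δ) (dOne (latticeConst (d + 1)) γ cG δ / 4)
      ∧ PosDecay (rho M) (id ∘ blkBox hn M) (id ∘ blkBox hn M) (shiftDiff μ (n : ℝ) (shiftDiffCol ν (n : ℝ) (1 - projR n M)))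
        ((((n : ℝ) ^ (d + 1))⁻¹) * ddConst (latticeConst (d + 1)) γ cG c δ) (dOne (latticeConst (d + 1)) γ cG δ / 4) := by
  have hd := rho_isPseudoDist M
  have hK0 := latticeConst_nonneg' d
  have hKp := posProfile_rho M
  have hP := rate_pos hK0 hγ hG.1 hδ
  have hS4 : 0 < dStar (latticeConst (d + 1)) γ cG δ := by unfold dStar; positivity
  -- gen 6's minimiser decays and the differentiated minimiser, all weakened to the common rate `δ* = δP/4`
  have hH : PosDecay (rho M) (id ∘ blkBox hn M) id (minimiser (boxOpR n 1 0 M) (Qn n M))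
      (sN d n * cG * (2 / γ) * latticeConst (d + 1) (rate (latticeConst (d + 1)) γ cG δ / 2)) (dStar (latticeConst (d + 1)) γ cG δ) :=
    PosDecay.mono hd.nonneg (posDecay_minimiser hn M hδ hγ hG hco) (by unfold dStar; linarith)
  have hH' : ColCubeDecay (rho M) (blkBox hn M) id (minimiser (boxOpR n 1 0 M) (Qn n M))
      (sN d n * ((n : ℝ) ^ (d + 1) * cG) * (2 / γ) * latticeConst (d + 1) (rate (latticeConst (d + 1)) γ cG δ / 2))
      (dStar (latticeConst (d + 1)) γ cG δ) :=
    ColCubeDecay.mono hd (colCube_minimiser hn M hδ hγ hG hco) (by unfold dStar; linarith)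
  have hdH : ∀ μ', PosDecay (rho M) (id ∘ blkBox hn M) id (shiftDiff μ' (n : ℝ) (minimiser (boxOpR n 1 0 M) (Qn n M)))
      (sN d n * c * (2 / γ) * latticeConst (d + 1) (rate (latticeConst (d + 1)) γ cG δ / 2)) (dStar (latticeConst (d + 1)) γ cG δ) :=
    fun μ' => PosDecay.mono hd.nonneg (posDecay_dMinimiser hn M hδ hγ hG (hdG μ') hco) (by unfold dStar; linarith)
  -- the capacitance and its inverse (coercivity 1), as in gen 7's `WoodburyFibreProjector.one_sub_projR_of_data`
  have hGram := gram_posDecay hd hK0 hKp hH hH' (δ' := dStar (latticeConst (d + 1)) γ cG δ / 2)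
    (g := dStar (latticeConst (d + 1)) γ cG δ / 2) (by positivity) (by positivity) (by linarith) (by linarith)
  have hprod : sN d n * cG * (2 / γ) * latticeConst (d + 1) (rate (latticeConst (d + 1)) γ cG δ / 2)
      * (sN d n * ((n : ℝ) ^ (d + 1) * cG) * (2 / γ) * latticeConst (d + 1) (rate (latticeConst (d + 1)) γ cG δ / 2))
      = piH (latticeConst (d + 1)) γ cG δ := by
    unfold piH
    calc _ = (sN d n * sN d n * (n : ℝ) ^ (d + 1)) * (cG ^ 2 * (2 / γ) ^ 2
        * latticeConst (d + 1) (rate (latticeConst (d + 1)) γ cG δ / 2) ^ 2) := by ring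
      _ = _ := by rw [sN_mul_sN_mul (d := d) hn, one_mul]
  rw [hprod] at hGram
  have hSi := B5Decay126.PosDecay.inv hd hK0 hKp one_pos (by positivity : 0 < dStar (latticeConst (d + 1)) γ cG δ / 2) hGram
    (gram_coercive hn M hM)
  change PosDecay (rho M) id id _ (2 / 1) (dOne (latticeConst (d + 1)) γ cG δ) at hSi
  have hDp := dOne_pos hK0 hγ hG.1 hδ
  have hDle : dOne (latticeConst (d + 1)) γ cG δ ≤ dStar (latticeConst (d + 1)) γ cG δ / 2 / 4 := rate_le_quarter _ _ _
  -- the (differentiated) leg times the inverse capacitance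
  have h2d := B5Decay126.PosDecay.mul hd hK0 hKp (hdH μ) hSi (δ' := dOne (latticeConst (d + 1)) γ cG δ / 2)
    (g := dOne (latticeConst (d + 1)) γ cG δ / 2) (by positivity) (by positivity) (by linarith) (by linarith)
  have h2 := B5Decay126.PosDecay.mul hd hK0 hKp hH hSi (δ' := dOne (latticeConst (d + 1)) γ cG δ / 2)
    (g := dOne (latticeConst (d + 1)) γ cG δ / 2) (by positivity) (by positivity) (by linarith) (by linarith)
  -- the four products
  have hDP := B5Decay126.PosDecay.mul hd hK0 hKp h2d (posDecay_conjTranspose hd hH) (δ' := dOne (latticeConst (d + 1)) γ cG δ / 4)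
    (g := dOne (latticeConst (d + 1)) γ cG δ / 4) (by positivity) (by positivity) (by linarith) (by linarith)
  have hDPc := posDecay_mul_colCube hd hK0 hKp h2d hH' (δ' := dOne (latticeConst (d + 1)) γ cG δ / 4)
    (g := dOne (latticeConst (d + 1)) γ cG δ / 4) (by positivity) (by positivity) (by linarith) (by linarith)
  have hPD := B5Decay126.PosDecay.mul hd hK0 hKp h2 (posDecay_conjTranspose hd (hdH ν)) (δ' := dOne (latticeConst (d + 1)) γ cG δ / 4)
    (g := dOne (latticeConst (d + 1)) γ cG δ / 4) (by positivity) (by positivity) (by linarith) (by linarith)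
  have hDPD := B5Decay126.PosDecay.mul hd hK0 hKp h2d (posDecay_conjTranspose hd (hdH ν)) (δ' := dOne (latticeConst (d + 1)) γ cG δ / 4)
    (g := dOne (latticeConst (d + 1)) γ cG δ / 4) (by positivity) (by positivity) (by linarith) (by linarith)
  -- the algebra `n·D_μP = (n·D_μℋ̃)·(ℋ̃ᴴℋ̃)⁻¹·ℋ̃ᴴ` etc.
  have hPeq := one_sub_projR hn M hM
  have eDP : shiftDiff μ (n : ℝ) (1 - projR n M) = shiftDiff μ (n : ℝ) (minimiser (boxOpR n 1 0 M) (Qn n M))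
      * ((minimiser (boxOpR n 1 0 M) (Qn n M))ᴴ * minimiser (boxOpR n 1 0 M) (Qn n M))⁻¹ * (minimiser (boxOpR n 1 0 M) (Qn n M))ᴴ := by
    rw [hPeq, shiftDiff_mul, shiftDiff_mul]
  have ePD : shiftDiffCol ν (n : ℝ) (1 - projR n M) = minimiser (boxOpR n 1 0 M) (Qn n M)
      * ((minimiser (boxOpR n 1 0 M) (Qn n M))ᴴ * minimiser (boxOpR n 1 0 M) (Qn n M))⁻¹
      * (shiftDiff ν (n : ℝ) (minimiser (boxOpR n 1 0 M) (Qn n M)))ᴴ := by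
    rw [hPeq, mul_shiftDiffCol, shiftDiffCol_conjTranspose]
  have eDPD : shiftDiff μ (n : ℝ) (shiftDiffCol ν (n : ℝ) (1 - projR n M)) = shiftDiff μ (n : ℝ) (minimiser (boxOpR n 1 0 M) (Qn n M))
      * ((minimiser (boxOpR n 1 0 M) (Qn n M))ᴴ * minimiser (boxOpR n 1 0 M) (Qn n M))⁻¹
      * (shiftDiff ν (n : ℝ) (minimiser (boxOpR n 1 0 M) (Qn n M)))ᴴ := by
    rw [ePD, Matrix.mul_assoc, shiftDiff_mul, ← Matrix.mul_assoc]
  -- the constants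
  have e1 : sN d n * c * (2 / γ) * latticeConst (d + 1) (rate (latticeConst (d + 1)) γ cG δ / 2) * (2 / 1)
      * latticeConst (d + 1) (dOne (latticeConst (d + 1)) γ cG δ / 2)
      * (sN d n * cG * (2 / γ) * latticeConst (d + 1) (rate (latticeConst (d + 1)) γ cG δ / 2))
      * latticeConst (d + 1) (dOne (latticeConst (d + 1)) γ cG δ / 4)
      = ((n : ℝ) ^ (d + 1))⁻¹ * dConst (latticeConst (d + 1)) γ cG c δ := by
    rw [← sN_mul_sN hn]; unfold dConst; ring
  have e1c : sN d n * c * (2 / γ) * latticeConst (d + 1) (rate (latticeConst (d + 1)) γ cG δ / 2) * (2 / 1)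
      * latticeConst (d + 1) (dOne (latticeConst (d + 1)) γ cG δ / 2)
      * (sN d n * ((n : ℝ) ^ (d + 1) * cG) * (2 / γ) * latticeConst (d + 1) (rate (latticeConst (d + 1)) γ cG δ / 2))
      * latticeConst (d + 1) (dOne (latticeConst (d + 1)) γ cG δ / 4)
      = dConst (latticeConst (d + 1)) γ cG c δ := by
    have : sN d n * c * (2 / γ) * latticeConst (d + 1) (rate (latticeConst (d + 1)) γ cG δ / 2) * (2 / 1)
        * latticeConst (d + 1) (dOne (latticeConst (d + 1)) γ cG δ / 2)
        * (sN d n * ((n : ℝ) ^ (d + 1) * cG) * (2 / γ) * latticeConst (d + 1) (rate (latticeConst (d + 1)) γ cG δ / 2))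
        * latticeConst (d + 1) (dOne (latticeConst (d + 1)) γ cG δ / 4)
        = (sN d n * sN d n * (n : ℝ) ^ (d + 1)) * dConst (latticeConst (d + 1)) γ cG c δ := by unfold dConst; ring
    rw [this, sN_mul_sN_mul (d := d) hn, one_mul]
  have e2 : sN d n * cG * (2 / γ) * latticeConst (d + 1) (rate (latticeConst (d + 1)) γ cG δ / 2) * (2 / 1)
      * latticeConst (d + 1) (dOne (latticeConst (d + 1)) γ cG δ / 2)
      * (sN d n * c * (2 / γ) * latticeConst (d + 1) (rate (latticeConst (d + 1)) γ cG δ / 2))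
      * latticeConst (d + 1) (dOne (latticeConst (d + 1)) γ cG δ / 4)
      = ((n : ℝ) ^ (d + 1))⁻¹ * dConst (latticeConst (d + 1)) γ cG c δ := by
    rw [← sN_mul_sN hn]; unfold dConst; ring
  have e3 : sN d n * c * (2 / γ) * latticeConst (d + 1) (rate (latticeConst (d + 1)) γ cG δ / 2) * (2 / 1)
      * latticeConst (d + 1) (dOne (latticeConst (d + 1)) γ cG δ / 2)
      * (sN d n * c * (2 / γ) * latticeConst (d + 1) (rate (latticeConst (d + 1)) γ cG δ / 2))
      * latticeConst (d + 1) (dOne (latticeConst (d + 1)) γ cG δ / 4)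
      = ((n : ℝ) ^ (d + 1))⁻¹ * ddConst (latticeConst (d + 1)) γ cG c δ := by
    rw [← sN_mul_sN hn]; unfold ddConst; ring
  rw [e1] at hDP
  rw [e1c] at hDPc
  rw [e2] at hPD
  rw [e3] at hDPD
  rw [eDPD, eDP, ePD]
  exact ⟨hDP, hDPc, hPD, hDPD⟩

/-- `0 < dConst` for the lattice profile and positive data. [folklore] -/
theorem dConst_pos (d : ℕ) {γ cG c δ : ℝ} (hγ : 0 < γ) (hcG : 0 < cG) (hc : 0 < c) (hδ : 0 < δ) :
    0 < dConst (latticeConst (d + 1)) γ cG c δ ∧ 0 < ddConst (latticeConst (d + 1)) γ cG c δ := by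
  have hK0 := latticeConst_nonneg' d
  have hP := rate_pos hK0 hγ hcG.le hδ
  have hD := dOne_pos hK0 hγ hcG.le hδ
  have hK1 : ∀ t : ℝ, 0 < t → 0 < latticeConst (d + 1) t :=
    fun t ht => lt_of_lt_of_le one_pos (B4Thm110ZeroBox.one_le_latticeConst d ht)
  have k1 := hK1 (rate (latticeConst (d + 1)) γ cG δ / 2) (by positivity)
  have k2 := hK1 (dOne (latticeConst (d + 1)) γ cG δ / 2) (by positivity)
  have k3 := hK1 (dOne (latticeConst (d + 1)) γ cG δ / 4) (by positivity)
  unfold dConst ddConst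
  exact ⟨by positivity, by positivity⟩

/-- monotonicity of the two constants in B4's constants `(cG, c)`. [folklore] -/
theorem dConst_mono (d : ℕ) {γ cG c c' δ : ℝ} (hγ : 0 < γ) (hcG : 0 ≤ cG) (hc : 0 ≤ c) (hcc' : c ≤ c') (hδ : 0 < δ) :
    dConst (latticeConst (d + 1)) γ cG c δ ≤ dConst (latticeConst (d + 1)) γ cG c' δ
      ∧ ddConst (latticeConst (d + 1)) γ cG c δ ≤ ddConst (latticeConst (d + 1)) γ cG c' δ := by
  have hK0 := latticeConst_nonneg' d
  have hP := rate_pos hK0 hγ hcG hδ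
  have hD := dOne_pos hK0 hγ hcG hδ
  have hrest : 0 ≤ (2 / γ) ^ 2 * latticeConst (d + 1) (rate (latticeConst (d + 1)) γ cG δ / 2) ^ 2 * 2
      * latticeConst (d + 1) (dOne (latticeConst (d + 1)) γ cG δ / 2) * latticeConst (d + 1) (dOne (latticeConst (d + 1)) γ cG δ / 4) :=
    mul_nonneg (mul_nonneg (by positivity) (hK0 _ (by positivity))) (hK0 _ (by positivity))
  unfold dConst ddConst
  constructor
  · have e : ∀ t : ℝ, t * cG * (2 / γ) ^ 2 * latticeConst (d + 1) (rate (latticeConst (d + 1)) γ cG δ / 2) ^ 2 * 2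
        * latticeConst (d + 1) (dOne (latticeConst (d + 1)) γ cG δ / 2) * latticeConst (d + 1) (dOne (latticeConst (d + 1)) γ cG δ / 4)
        = (t * cG) * ((2 / γ) ^ 2 * latticeConst (d + 1) (rate (latticeConst (d + 1)) γ cG δ / 2) ^ 2 * 2
        * latticeConst (d + 1) (dOne (latticeConst (d + 1)) γ cG δ / 2) * latticeConst (d + 1) (dOne (latticeConst (d + 1)) γ cG δ / 4)) :=
      fun t => by ring
    rw [e, e]
    exact mul_le_mul_of_nonneg_right (mul_le_mul_of_nonneg_right hcc' hcG) hrest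
  · have e : ∀ t : ℝ, t * t * (2 / γ) ^ 2 * latticeConst (d + 1) (rate (latticeConst (d + 1)) γ cG δ / 2) ^ 2 * 2
        * latticeConst (d + 1) (dOne (latticeConst (d + 1)) γ cG δ / 2) * latticeConst (d + 1) (dOne (latticeConst (d + 1)) γ cG δ / 4)
        = (t * t) * ((2 / γ) ^ 2 * latticeConst (d + 1) (rate (latticeConst (d + 1)) γ cG δ / 2) ^ 2 * 2
        * latticeConst (d + 1) (dOne (latticeConst (d + 1)) γ cG δ / 2) * latticeConst (d + 1) (dOne (latticeConst (d + 1)) γ cG δ / 4)) :=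
      fun t => by ring
    rw [e, e]
    exact mul_le_mul_of_nonneg_right (mul_le_mul hcc' hcc' hc (hc.trans hcc')) hrest

/-- **THE DERIVATIVE ENTRIES OF `1 − R`, UNIFORMLY IN THE SCALE** (census row V12; the `U = 1` box case of the `DP`, `PD*`, `DPD*` entries of [B9]
(3.49)): for every `d`, `L = ℓ+1 ≥ 2` there are `δ, C > 0` such that for EVERY `k ≥ 1` (`n = L^k`), every box of unit blocks and all axes `μ, ν`,
with `P = 1 − projR n M`: `|n(P(x+e_μ,x′) − P(x,x′))| ≤ C·n^{−(d+1)}·e^{−δ|blk x − blk x′|_∞}` (and its cube form `Σ_{x′ ∈ b′} ≤ C·e^{−δ rho}`),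
`|n(P(x,x′+e_ν) − P(x,x′))| ≤ C·n^{−(d+1)}·e^{−δ|blk x − blk x′|_∞}`, `|n²(P(x+e_μ,x′+e_ν) − P(x+e_μ,x′) − P(x,x′+e_ν) + P(x,x′))| ≤
C·n^{−(d+1)}·e^{−δ|blk x − blk x′|_∞}` whenever the shifted points lie in the box (the matrices `shiftDiff`∕`shiftDiffCol` carry exactly these
entries there, `shiftDiff_apply_of_mem` etc., and `0` elsewhere). [folklore] -/
theorem one_sub_projR_deriv_decay (d ℓ : ℕ) (hℓ : 1 ≤ ℓ) :
    ∃ δ C : ℝ, 0 < δ ∧ 0 < C ∧ ∀ (k : ℕ) (hk : 1 ≤ k) (M : Fin (d + 1) → ℕ), (∀ i, 1 ≤ M i) → ∀ μ ν : Fin (d + 1),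
      PosDecay (rho M) (id ∘ blkBox (Nat.one_le_pow k (ℓ + 1) (Nat.succ_pos ℓ)) M) (id ∘ blkBox (Nat.one_le_pow k (ℓ + 1) (Nat.succ_pos ℓ)) M)
          (shiftDiff μ ((((ℓ + 1) ^ k : ℕ)) : ℝ) (1 - projR ((ℓ + 1) ^ k) M)) (C * ((((ℓ + 1) ^ k : ℕ) : ℝ) ^ (d + 1))⁻¹) δ
        ∧ CubeDecay (rho M) (blkBox (Nat.one_le_pow k (ℓ + 1) (Nat.succ_pos ℓ)) M) id
          (shiftDiff μ ((((ℓ + 1) ^ k : ℕ)) : ℝ) (1 - projR ((ℓ + 1) ^ k) M)) C δ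
        ∧ PosDecay (rho M) (id ∘ blkBox (Nat.one_le_pow k (ℓ + 1) (Nat.succ_pos ℓ)) M) (id ∘ blkBox (Nat.one_le_pow k (ℓ + 1) (Nat.succ_pos ℓ)) M)
          (shiftDiffCol ν ((((ℓ + 1) ^ k : ℕ)) : ℝ) (1 - projR ((ℓ + 1) ^ k) M)) (C * ((((ℓ + 1) ^ k : ℕ) : ℝ) ^ (d + 1))⁻¹) δ
        ∧ PosDecay (rho M) (id ∘ blkBox (Nat.one_le_pow k (ℓ + 1) (Nat.succ_pos ℓ)) M) (id ∘ blkBox (Nat.one_le_pow k (ℓ + 1) (Nat.succ_pos ℓ)) M)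
          (shiftDiff μ ((((ℓ + 1) ^ k : ℕ)) : ℝ) (shiftDiffCol ν ((((ℓ + 1) ^ k : ℕ)) : ℝ) (1 - projR ((ℓ + 1) ^ k) M)))
          (C * ((((ℓ + 1) ^ k : ℕ) : ℝ) ^ (d + 1))⁻¹) δ := by
  obtain ⟨δ₀, c₀, hδ₀, hc₀, hG⟩ := cubeDecay_boxGreen d ℓ hℓ 1 1 0 one_pos
  obtain ⟨δ₁, c₁, hδ₁, hc₁, hdG⟩ := cubeDecay_boxGreen_deriv d ℓ hℓ 1 1 0 one_pos
  have hγ : 0 < gammaQ (d + 1) (0 + 1) := gammaQ_pos _ (by norm_num)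
  have hδm0 : 0 < min δ₀ δ₁ := lt_min hδ₀ hδ₁
  -- ONE constant: the larger of `dConst`, `ddConst` at `c := max c₀ c₁`
  obtain ⟨hd1, hd2⟩ := dConst_pos d hγ hc₀ (lt_max_of_lt_left hc₀ : 0 < max c₀ c₁) hδm0
  refine ⟨dOne (latticeConst (d + 1)) (gammaQ (d + 1) (0 + 1)) c₀ (min δ₀ δ₁) / 4,
    max (dConst (latticeConst (d + 1)) (gammaQ (d + 1) (0 + 1)) c₀ (max c₀ c₁) (min δ₀ δ₁))
      (ddConst (latticeConst (d + 1)) (gammaQ (d + 1) (0 + 1)) c₀ (max c₀ c₁) (min δ₀ δ₁)),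
    div_pos (dOne_pos (latticeConst_nonneg' d) hγ hc₀.le hδm0) (by norm_num), lt_max_of_lt_left hd1, fun k hk M hM μ ν => ?_⟩
  have hn : 1 ≤ (ℓ + 1) ^ k := Nat.one_le_pow k (ℓ + 1) (Nat.succ_pos ℓ)
  have hd := rho_isPseudoDist M
  have hGk : CubeDecay (rho M) (blkBox hn M) id (boxOpR ((ℓ + 1) ^ k) 1 0 M)⁻¹ c₀ (min δ₀ δ₁) :=
    CubeDecay.mono hd (hG k hk 1 0 le_rfl le_rfl le_rfl le_rfl M hM) (min_le_left _ _)
  have hdGk : ∀ μ', CubeDecay (rho M) (blkBox hn M) id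
      (shiftDiff μ' ((((ℓ + 1) ^ k : ℕ)) : ℝ) (boxOpR ((ℓ + 1) ^ k) 1 0 M)⁻¹) c₁ (min δ₀ δ₁) :=
    fun μ' => CubeDecay.mono hd (hdG k hk 1 0 le_rfl le_rfl le_rfl le_rfl M hM μ') (min_le_right _ _)
  obtain ⟨h1, h2, h3, h4⟩ :=
    one_sub_projR_deriv_of_data hn M hM hδm0 hγ hGk hdGk (qGq_box_coercive (d := d) hn one_pos le_rfl hM) μ ν
  obtain ⟨m1, m2⟩ := dConst_mono d hγ hc₀.le hc₁.le (le_max_right c₀ c₁) hδm0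
  have hN : (0 : ℝ) ≤ (((((ℓ + 1) ^ k : ℕ)) : ℝ) ^ (d + 1))⁻¹ := by positivity
  refine ⟨B5Decay126.PosDecay.const_mono h1 ?_, ⟨le_max_of_le_left hd1.le, fun x b' => (h2.2 x b').trans ?_⟩,
    B5Decay126.PosDecay.const_mono h3 ?_, B5Decay126.PosDecay.const_mono h4 ?_⟩
  · rw [mul_comm]; exact mul_le_mul_of_nonneg_right (m1.trans (le_max_left _ _)) hN
  · exact mul_le_mul_of_nonneg_right (m1.trans (le_max_left _ _)) (Real.exp_pos _).le
  · rw [mul_comm]; exact mul_le_mul_of_nonneg_right (m1.trans (le_max_left _ _)) hN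
  · rw [mul_comm]; exact mul_le_mul_of_nonneg_right (m2.trans (le_max_right _ _)) hN

/-! ## §4 Non-vacuity: the physical case `d + 1 = 4`, `L = 2` -/

/-- `one_sub_projR_deriv_decay` at `d + 1 = 4`, `L = 2`; the prefix is inhabited (`k = 1`, `M ≡ 1`, `μ = ν = 0`). -/
example : ∃ δ C : ℝ, 0 < δ ∧ 0 < C ∧ ∀ (k : ℕ) (hk : 1 ≤ k) (M : Fin (3 + 1) → ℕ), (∀ i, 1 ≤ M i) → ∀ μ ν : Fin (3 + 1),
      PosDecay (rho M) (id ∘ blkBox (Nat.one_le_pow k (1 + 1) (Nat.succ_pos 1)) M) (id ∘ blkBox (Nat.one_le_pow k (1 + 1) (Nat.succ_pos 1)) M)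
          (shiftDiff μ ((((1 + 1) ^ k : ℕ)) : ℝ) (1 - projR ((1 + 1) ^ k) M)) (C * ((((1 + 1) ^ k : ℕ) : ℝ) ^ (3 + 1))⁻¹) δ
        ∧ CubeDecay (rho M) (blkBox (Nat.one_le_pow k (1 + 1) (Nat.succ_pos 1)) M) id
          (shiftDiff μ ((((1 + 1) ^ k : ℕ)) : ℝ) (1 - projR ((1 + 1) ^ k) M)) C δ
        ∧ PosDecay (rho M) (id ∘ blkBox (Nat.one_le_pow k (1 + 1) (Nat.succ_pos 1)) M) (id ∘ blkBox (Nat.one_le_pow k (1 + 1) (Nat.succ_pos 1)) M)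
          (shiftDiffCol ν ((((1 + 1) ^ k : ℕ)) : ℝ) (1 - projR ((1 + 1) ^ k) M)) (C * ((((1 + 1) ^ k : ℕ) : ℝ) ^ (3 + 1))⁻¹) δ
        ∧ PosDecay (rho M) (id ∘ blkBox (Nat.one_le_pow k (1 + 1) (Nat.succ_pos 1)) M) (id ∘ blkBox (Nat.one_le_pow k (1 + 1) (Nat.succ_pos 1)) M)
          (shiftDiff μ ((((1 + 1) ^ k : ℕ)) : ℝ) (shiftDiffCol ν ((((1 + 1) ^ k : ℕ)) : ℝ) (1 - projR ((1 + 1) ^ k) M)))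
          (C * ((((1 + 1) ^ k : ℕ) : ℝ) ^ (3 + 1))⁻¹) δ :=
  one_sub_projR_deriv_decay 3 1 le_rfl

end

end Summit.QuantumFields.BalabanUV.Beta.GAN24.WoodburyFibreProjectorDeriv
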